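import Literature.LinearAlgebra.Matrix.StableLatticeClassesMaximalOrder
import Mathlib.NumberTheory.Cyclotomic.PrimitiveRoots
import Mathlib.RingTheory.Polynomial.Cyclotomic.Roots
import Mathlib.RingTheory.Polynomial.Cyclotomic.Eval
import Mathlib.LinearAlgebra.Matrix.Charpoly.Minpoly
import HarnessLib

/-!
# Integer matrices with characteristic polynomial `Φ_n`, and the elements of prime order `p` of `GL_{p−1}(ℤ)`:
# **exactly `h(ℚ(ζ_n))` classes** (Latimer–MacDuffee 1933 / Taussky 1949 for `f = Φ_n`, `ℤ[ζ_n]` maximal)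

[topic LinearAlgebra/Matrix] Lane `lit-hodgefound` (Track 2 foundations library), seat p15 generation 39, row g39-#2 —
the CYCLOTOMIC EVALUATION of the Latimer–MacDuffee–Taussky correspondence, through g39-#1
`StableLatticeClassesMaximalOrder` (exact count `h_K` for the maximal order) and Mathlib's `ℤ[ζ_n] = 𝒪_{ℚ(ζ_n)}`
(`IsCyclotomicExtension.Rat.adjoin_singleton_eq_top`).  THEOREMS ONLY (no definition, no instance, no named fact;
D-0026 net Literature debt `0`; no `sorry`).  The abstract rank-one correspondence (classes of matrix roots of an
irreducible `f` ↔ ideal classes of `ℤ[θ]`) is the tree's `LatimerMacDuffeeCorrespondence` and is NOT restated: this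
file evaluates the number of classes for `f = Φ_n`.

## Sources, VERBATIM

J. Brzeziński, *On two classical theorems in the theory of orders*, J. Number Theory 34 (1990) 21–32
[Brzezinski1990] (held `paper:doi-10-1016-0022-314x-90-90049-w`, p0001): «The first theorem was published by
C. G. Latimer and C. C. MacDuffee in 1933 (see [6, 9]): **(0.1) THEOREM.** Let `Λ = M_n(ℤ)` and let `S = ℤ[θ]`, where
`f(θ) = 0` for a monic separable polynomial `f ∈ ℤ[X]` of degree `n`. Then there is a one-to-one correspondence
between the `Λ* = GL_n(ℤ)`-orbits on the (ring-)embeddings of `S` into `Λ` and the ideal classes of `S`. Notice that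
if `φ : S → Λ` is an embedding, then the action of `Λ*` is defined by conjugation […]. Of course, there is a bijection
between the embeddings and the solutions to `f(X) = 0` in `Λ`.» ([6] = C. G. Latimer, C. C. MacDuffee, Ann. of
Math. 34 (1933) [LatimerMacduffee1933]; [9] = O. Taussky, Canad. J. Math. 1 (1949) [Taussky1949], Thms. 1–4.)
Applied to `f = Φ_n` (`n`-th cyclotomic polynomial, degree `φ(n)`, irreducible over `ℚ`) and `S = ℤ[ζ_n]`, which IS the
maximal order of `ℚ(ζ_n)` (Mathlib), the ideal classes of `S` are the `h(ℚ(ζ_n))` elements of `Cl(𝒪_{ℚ(ζ_n)})`.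
S. Marseglia, Res. Number Theory 11 (2025) [Marseglia2025ModulesOverOrders], §3 Prop. 3.1, §4 Thm. 4.1 (the
semisimple correspondence used by g38/g39, held `paper:arxiv-2208.05409`).

## What is formalised (any field `K` with `IsCyclotomicExtension {n} ℚ K`, `n ≥ 1`)

* §1 the model `(V, T) = (K, x ↦ ζ_n x)` over `ℚ`: `Φ_n(T) = 0` (`aeval_lmul_cyclotomic`), **`χ_T = Φ_n`**
  (`charpoly_lmul_eq_cyclotomic`, Mathlib's `charpoly_leftMulMatrix` on the power basis of `ζ_n` +
  `cyclotomic_eq_minpoly_rat`), `T` semisimple (`isSemisimple_lmul`).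
* §2 **`#{B ∈ M_{φ(n)}(ℤ) : χ_B = Φ_n}/GL_{φ(n)}(ℤ) = h(K)`** (`natCard_quot_conj_charpoly_cyclotomic`): g38-#3's
  bijection with the classes of `T`-stable lattices, g39-#1's transfer to `GL_K(K)`-classes of `ζ_n`-stable lattices,
  g39-#1's cyclotomic count; «semisimple» is automatic for `χ_B = Φ_n` (`isSemisimple_of_charpoly_eq_cyclotomic`,
  `natCard_quot_conj_isSemisimple_charpoly_cyclotomic` is the intermediate form).
* §3 `p` prime, `N = p − 1`: **`B^p = 1 ∧ B ≠ 1 ⟺ χ_B = Φ_p`** for `B ∈ M_{p−1}(ℤ)`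
  (`pow_prime_eq_one_and_ne_one_iff_charpoly_eq_cyclotomic`: `⇒` because `μ_B ∣ X^p − 1 = (X − 1)Φ_p` and
  `Φ_p ∤ χ_B` would force `μ_B ∣ X − 1` by the tree's `irreducible_dvd_charpoly_iff_dvd_minpoly`; `⇐` by Cayley–Hamilton
  and `Φ_p(1) = p ≠ 0`), hence **THE ELEMENTS OF ORDER `p` OF `GL_{p−1}(ℤ)` FALL INTO EXACTLY `h(ℚ(ζ_p))` CONJUGACY
  CLASSES** (`natCard_quot_conj_pow_prime_eq_one`; e.g. `p = 2`: the single class of `−1 ∈ GL_1(ℤ)`; `p = 3`: one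
  class in `GL_2(ℤ)` since `h(ℚ(ζ_3)) = 1`).

Not here: composite `n` and «order exactly `n`» in `GL_{φ(n)}(ℤ)` (for composite `n` an element of order `n` of
`GL_{φ(n)}(ℤ)` need not have `χ = Φ_n`, e.g. `χ = Φ_3Φ_4` of order `12` in `GL_4(ℤ)`), matrices of order `p` in other
dimensions (Reiner's classification of `ℤC_p`-lattices), and any class-number value.

## References
* [Brzezinski1990] J. Brzeziński, J. Number Theory 34 (1990) 21–32, (0.1) Theorem. [cite: Brzezinski1990, (0.1) Theorem, p. 21]
* [LatimerMacduffee1933] C. G. Latimer, C. C. MacDuffee, Ann. of Math. 34 (1933) 313–316.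
* [Taussky1949] O. Taussky, Canad. J. Math. 1 (1949) 300–302, Thms. 1–4.
* [Marseglia2025ModulesOverOrders] S. Marseglia, Res. Number Theory 11 (2025), §3 Prop. 3.1, §4 Thm. 4.1.
* J. Kuzmanovich, A. Pavlichenkov, *Finite groups of matrices whose entries are integers*, Amer. Math. Monthly 109
  (2002) 173–186 — not consulted (paywalled; acquisition request acq-14286), not cited on any declaration.
-/

noncomputable section

open scoped Classical nonZeroDivisors NumberField
open Polynomial Module Submodule

namespace Literature.LinearAlgebra.Matrix.CyclotomicIntegerMatrixClasses

open Literature.LinearAlgebra.Matrix.StableLatticeClassesMaximalOrder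
  (natCard_quot_centralizer_eq_natCard_quot_linearEquiv natCard_quot_eq_card_classGroup_of_isPrimitiveRoot)

/-! ## §1 The model `(K, x ↦ ζ x)` over `ℚ` -/

section Model

variable {n : ℕ} [NeZero n] {K : Type} [Field K] [NumberField K] [IsCyclotomicExtension {n} ℚ K]

omit [IsCyclotomicExtension {n} ℚ K] in
/-- `Φ_n(T) = 0` for `T = (x ↦ ζ x)` on `K`, `ζ` a primitive `n`-th root of unity (`Φ_n` is the minimal polynomial of
`ζ` over `ℚ`). [cite: Brzezinski1990, (0.1) Theorem («the solutions to `f(X) = 0` in `Λ`»), p. 21] -/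
theorem aeval_lmul_cyclotomic {ζ : K} (hζ : IsPrimitiveRoot ζ n) :
    aeval (Algebra.lmul ℚ K ζ) (cyclotomic n ℚ) = 0 := by
  rw [Polynomial.aeval_algHom_apply, cyclotomic_eq_minpoly_rat hζ (NeZero.pos n), minpoly.aeval, map_zero]

/-- **`χ_T = Φ_n`** for `T = (x ↦ ζ_n x)` on the cyclotomic field `K = ℚ(ζ_n)` viewed over `ℚ` (the characteristic
polynomial of multiplication by a generator of a power basis is its minimal polynomial). [cite: Brzezinski1990, (0.1) Theorem (with `f = Φ_n`, `S = ℤ[ζ_n]`), p. 21] -/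
theorem charpoly_lmul_eq_cyclotomic {ζ : K} (hζ : IsPrimitiveRoot ζ n) :
    (Algebra.lmul ℚ K ζ).charpoly = (cyclotomic n ℤ).map (Int.castRingHom ℚ) := by
  have h1 := charpoly_leftMulMatrix (hζ.powerBasis ℚ)
  rw [IsPrimitiveRoot.powerBasis_gen, Algebra.leftMulMatrix_apply, LinearMap.charpoly_toMatrix] at h1
  rw [h1, ← cyclotomic_eq_minpoly_rat hζ (NeZero.pos n), map_cyclotomic_int]

omit [IsCyclotomicExtension {n} ℚ K] in
/-- `T = (x ↦ ζ x)` is semisimple (its minimal polynomial `Φ_n` is square-free). [cite: Marseglia2025ModulesOverOrders, §4 («since `m` is squarefree, these matrices are semisimple»), chunk p0009] -/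
theorem isSemisimple_lmul {ζ : K} (hζ : IsPrimitiveRoot ζ n) : (Algebra.lmul ℚ K ζ).IsSemisimple :=
  Module.End.isSemisimple_of_squarefree_aeval_eq_zero (cyclotomic.irreducible_rat (NeZero.pos n)).squarefree
    (aeval_lmul_cyclotomic hζ)

end Model

/-! ## §2 The integer matrices with characteristic polynomial `Φ_n`: exactly `h(ℚ(ζ_n))` classes -/

section Count

variable {n : ℕ} [NeZero n] (K : Type) [Field K] [NumberField K] [IsCyclotomicExtension {n} ℚ K]

/-- Intermediate form (Marseglia's `𝓜_{Φ_n, Φ_n}(ℤ)`): the SEMISIMPLE integer `N × N` matrices (`N = φ(n)`) with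
characteristic polynomial `Φ_n`, modulo `GL_N(ℤ)`-conjugacy, number exactly `h(K)` for any cyclotomic field
`K = ℚ(ζ_n)` — the model is `(K, x ↦ ζ_n x)`, whose commutant is `GL_K(K)`, and `ℤ[ζ_n] = 𝒪_K`.
[cite: Brzezinski1990, (0.1) Theorem (with `f = Φ_n`), p. 21] [cite: Marseglia2025ModulesOverOrders, §3 Prop. 3.1 and §4 Thm. 4.1, chunks p0006, p0008–p0009] -/
theorem natCard_quot_conj_isSemisimple_charpoly_cyclotomic {N : ℕ} (hN : n.totient = N) :
    Nat.card (Quot (fun B B' : {B : _root_.Matrix (Fin N) (Fin N) ℤ //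
          Module.End.IsSemisimple (Matrix.toLin' (B.map (Int.castRingHom ℚ))) ∧ B.charpoly = cyclotomic n ℤ} =>
        ∃ Q : _root_.Matrix (Fin N) (Fin N) ℤ, IsUnit Q.det ∧ Q * B.1 = B'.1 * Q)) =
      Fintype.card (ClassGroup (𝓞 K)) := by
  have hζ := IsCyclotomicExtension.zeta_spec n ℚ K
  set ζ := IsCyclotomicExtension.zeta n ℚ K with hζdef
  have hn : finrank ℚ K = N := by
    rw [← hN]; exact IsCyclotomicExtension.finrank K (cyclotomic.irreducible_rat (NeZero.pos n))
  -- g38-#3: matrix classes = classes of `T`-stable lattices modulo the commutant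
  have h1 := LatimerMacDuffeeSemisimple.natCard_quot_conj_eq_of_isSemisimple hn (Algebra.lmul ℚ K ζ)
    (isSemisimple_lmul hζ) (charpoly_lmul_eq_cyclotomic hζ)
  -- g39-#1: the commutant of `T` is `GL_K(K)` (`ℚ(ζ) = K`)
  have hθ : ∀ w : K, ζ • w = Algebra.lmul ℚ K ζ w := fun w => by
    rw [Algebra.coe_lmul_eq_mul, LinearMap.mul_apply', smul_eq_mul]
  have h2 := natCard_quot_centralizer_eq_natCard_quot_linearEquiv
    (IsCyclotomicExtension.adjoin_primitive_root_eq_top hζ) (Algebra.lmul ℚ K ζ) hθ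
  -- g39-#1: `ℤ[ζ] = 𝒪_K`, exactly `h_K` classes
  have h3 := natCard_quot_eq_card_classGroup_of_isPrimitiveRoot (K := K) (W := K) hζ
  exact h1.trans (h2.trans h3)

omit [NeZero n] in
/-- An integer matrix with characteristic polynomial `Φ_n` is semisimple over `ℚ` (Cayley–Hamilton: `Φ_n(B) = 0`, and
`Φ_n` is square-free). [cite: Marseglia2025ModulesOverOrders, §4 («since `m` is squarefree, these matrices are semisimple»), chunk p0009] -/
theorem isSemisimple_of_charpoly_eq_cyclotomic (hn : 0 < n) {N : ℕ} {B : _root_.Matrix (Fin N) (Fin N) ℤ}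
    (hB : B.charpoly = cyclotomic n ℤ) :
    Module.End.IsSemisimple (Matrix.toLin' (B.map (Int.castRingHom ℚ))) := by
  refine Module.End.isSemisimple_of_squarefree_aeval_eq_zero (cyclotomic.irreducible_rat hn).squarefree ?_
  have h1 : (Matrix.toLin' (B.map (Int.castRingHom ℚ))).charpoly = cyclotomic n ℚ := by
    rw [Matrix.charpoly_toLin', Matrix.charpoly_map, hB, map_cyclotomic_int]
  rw [← h1]
  exact LinearMap.aeval_self_charpoly _

/-- **THE INTEGER MATRICES WITH CHARACTERISTIC POLYNOMIAL `Φ_n` FORM EXACTLY `h(ℚ(ζ_n))` CLASSES UNDER `GL(ℤ)`.**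
For `n ≥ 1`, `N = φ(n)` and any cyclotomic field `K = ℚ(ζ_n)`: the `N × N` integer matrices `B` with `χ_B = Φ_n`,
modulo `B ∼ B′ :⟺ QB = B′Q` for some `Q ∈ GL_N(ℤ)`, number exactly `#Cl(𝒪_K)` — Latimer–MacDuffee–Taussky
(«one-to-one correspondence between the `GL_n(ℤ)`-orbits on the … solutions to `f(X) = 0` in `Λ` and the ideal classes
of `S = ℤ[θ]`») for `f = Φ_n`, whose order `ℤ[ζ_n]` is the maximal order. [cite: Brzezinski1990, (0.1) Theorem, p. 21] [cite: Taussky1949, Thms. 1–4] [cite: LatimerMacduffee1933, Theorem] -/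
theorem natCard_quot_conj_charpoly_cyclotomic {N : ℕ} (hN : n.totient = N) :
    Nat.card (Quot (fun B B' : {B : _root_.Matrix (Fin N) (Fin N) ℤ // B.charpoly = cyclotomic n ℤ} =>
        ∃ Q : _root_.Matrix (Fin N) (Fin N) ℤ, IsUnit Q.det ∧ Q * B.1 = B'.1 * Q)) =
      Fintype.card (ClassGroup (𝓞 K)) := by
  rw [← natCard_quot_conj_isSemisimple_charpoly_cyclotomic K hN]
  set rS := (fun B B' : {B : _root_.Matrix (Fin N) (Fin N) ℤ //
      Module.End.IsSemisimple (Matrix.toLin' (B.map (Int.castRingHom ℚ))) ∧ B.charpoly = cyclotomic n ℤ} =>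
    ∃ Q : _root_.Matrix (Fin N) (Fin N) ℤ, IsUnit Q.det ∧ Q * B.1 = B'.1 * Q) with hrS
  let e : {B : _root_.Matrix (Fin N) (Fin N) ℤ // B.charpoly = cyclotomic n ℤ} ≃
      {B : _root_.Matrix (Fin N) (Fin N) ℤ //
        Module.End.IsSemisimple (Matrix.toLin' (B.map (Int.castRingHom ℚ))) ∧ B.charpoly = cyclotomic n ℤ} :=
    Equiv.subtypeEquivRight fun B =>
      ⟨fun h => ⟨isSemisimple_of_charpoly_eq_cyclotomic (NeZero.pos n) h, h⟩, fun h => h.2⟩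
  exact Nat.card_congr (Quot.congr (rb := rS) e fun B B' => Iff.rfl)

end Count

/-! ## §3 The elements of prime order `p` of `GL_{p−1}(ℤ)` -/

section PrimeOrder

variable {p : ℕ} [hp : Fact p.Prime]

/-- For `B ∈ M_{p−1}(ℤ)`, `p` prime: **`B^p = 1` and `B ≠ 1` iff `χ_B = Φ_p`.**  (`⇒`: `μ_B ∣ X^p − 1 = (X − 1)·Φ_p`; if
`Φ_p ∤ χ_B` then `Φ_p ∤ μ_B`, so `μ_B ∣ X − 1` and `B = 1`; hence `Φ_p ∣ χ_B`, and both are monic of degree `p − 1`.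
`⇐`: `Φ_p(B) = 0` by Cayley–Hamilton, so `B^p − 1 = Φ_p(B)(B − 1) = 0`; and `B = 1` would give
`0 = Φ_p(1)·1 = p·1`.)  This identifies, for `f = Φ_p` and `n = p − 1`, «the solutions to `f(X) = 0` in `Λ = M_n(ℤ)`»
of the Latimer–MacDuffee theorem with the matrices `X^p = 1`, `X ≠ 1` (an elementary reformulation proved here).
[cite: Brzezinski1990, (0.1) Theorem and the remark following it («there is a bijection between the embeddings and the solutions to f(X) = 0 in Λ»), p. 21] -/
theorem pow_prime_eq_one_and_ne_one_iff_charpoly_eq_cyclotomic (B : _root_.Matrix (Fin (p - 1)) (Fin (p - 1)) ℤ) :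
    (B ^ p = 1 ∧ B ≠ 1) ↔ B.charpoly = cyclotomic p ℤ := by
  have hp1 : 0 < p - 1 := Nat.sub_pos_of_lt hp.out.one_lt
  haveI : Nonempty (Fin (p - 1)) := ⟨⟨0, hp1⟩⟩
  let i₀ : Fin (p - 1) := ⟨0, hp1⟩
  constructor
  · rintro ⟨hBp, hB1⟩
    set f := Int.castRingHom ℚ with hf
    set Bq : _root_.Matrix (Fin (p - 1)) (Fin (p - 1)) ℚ := B.map f with hBq
    have hBqp : Bq ^ p = 1 := by
      rw [hBq, ← RingHom.mapMatrix_apply, ← map_pow, hBp, map_one]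
    have hBq1 : Bq ≠ 1 := fun h => hB1 (by
      have h' : B.map f = (1 : _root_.Matrix (Fin (p - 1)) (Fin (p - 1)) ℤ).map f := by
        rw [← hBq, h, Matrix.map_one f (map_zero f) (map_one f)]
      exact Matrix.map_injective f.injective_int h')
    -- `μ ∣ X^p − 1 = (X − 1)Φ_p`
    have hμ : minpoly ℚ Bq ∣ (X - 1) * cyclotomic p ℚ := by
      rw [mul_comm, cyclotomic_prime_mul_X_sub_one]
      exact minpoly.dvd ℚ Bq (by simp [hBqp])
    have hirr : Irreducible (cyclotomic p ℚ) := cyclotomic.irreducible_rat hp.out.pos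
    -- `Φ_p ∣ χ`
    have hdvd : cyclotomic p ℚ ∣ Bq.charpoly := by
      by_contra hnd
      have hnd' : ¬ cyclotomic p ℚ ∣ minpoly ℚ Bq := fun h => hnd (by
        have h2 := (Literature.LinearAlgebra.irreducible_dvd_charpoly_iff_dvd_minpoly (Matrix.toLin' Bq) hirr).2
        rw [Matrix.charpoly_toLin', Matrix.minpoly_toLin'] at h2
        exact h2 h)
      have hcop : IsCoprime (minpoly ℚ Bq) (cyclotomic p ℚ) := (hirr.coprime_iff_not_dvd.2 hnd').symm
      have h3 : minpoly ℚ Bq ∣ X - 1 := hcop.dvd_of_dvd_mul_right hμ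
      have h4 : aeval Bq (X - 1 : ℚ[X]) = 0 := by
        obtain ⟨r, hr⟩ := h3
        rw [hr, map_mul, minpoly.aeval, zero_mul]
      rw [map_sub, aeval_X, aeval_one, sub_eq_zero] at h4
      exact hBq1 h4
    -- degrees: `χ` and `Φ_p` are monic of degree `p − 1`
    have heq : Bq.charpoly = cyclotomic p ℚ := by
      refine Polynomial.eq_of_monic_of_dvd_of_natDegree_le (cyclotomic.monic p ℚ) Bq.charpoly_monic hdvd ?_
      rw [Matrix.charpoly_natDegree_eq_dim, Fintype.card_fin, natDegree_cyclotomic, Nat.totient_prime hp.out]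
    apply Polynomial.map_injective f f.injective_int
    rw [← Matrix.charpoly_map, ← hBq, heq, map_cyclotomic_int]
  · intro hB
    have hCH : aeval B (cyclotomic p ℤ) = 0 := by rw [← hB]; exact Matrix.aeval_self_charpoly B
    constructor
    · have h1 : aeval B (X ^ p - 1 : ℤ[X]) = 0 := by
        rw [← cyclotomic_prime_mul_X_sub_one, map_mul, hCH, zero_mul]
      rwa [map_sub, map_pow, aeval_X, aeval_one, sub_eq_zero] at h1
    · intro h1
      rw [h1, show (1 : _root_.Matrix (Fin (p - 1)) (Fin (p - 1)) ℤ) = algebraMap ℤ _ 1 from (map_one _).symm,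
        aeval_algebraMap_apply_eq_algebraMap_eval, eval_one_cyclotomic_prime] at hCH
      have h2 := congr_fun (congr_fun hCH i₀) i₀
      rw [Matrix.algebraMap_matrix_apply, if_pos rfl, Matrix.zero_apply] at h2
      have h3 : (p : ℤ) = 0 := by simpa using h2
      exact hp.out.ne_zero (by exact_mod_cast h3)

/-- **THE ELEMENTS OF ORDER `p` OF `GL_{p−1}(ℤ)` FALL INTO EXACTLY `h(ℚ(ζ_p))` CONJUGACY CLASSES** (`p` prime).
The integer `(p−1) × (p−1)` matrices `B` with `B^p = 1`, `B ≠ 1` (all unimodular), modulo `B ∼ QBQ⁻¹` with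
`Q ∈ GL_{p−1}(ℤ)`, number exactly `#Cl(𝒪_K)` for any cyclotomic field `K = ℚ(ζ_p)`: they are the matrices with
`χ_B = Φ_p` (§3), i.e. the matrix roots of the irreducible `Φ_p` of degree `p − 1`, whose classes correspond to the ideal
classes of `ℤ[ζ_p] = 𝒪_K` (Latimer–MacDuffee–Taussky).  For `p = 2` this is the single class `{−1} ⊂ GL_1(ℤ)`.
[cite: Brzezinski1990, (0.1) Theorem (with `f = Φ_p`, `n = p − 1`), p. 21] [cite: Taussky1949, Thms. 1–4] [cite: LatimerMacduffee1933, Theorem] -/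
theorem natCard_quot_conj_pow_prime_eq_one (K : Type) [Field K] [NumberField K] [IsCyclotomicExtension {p} ℚ K] :
    Nat.card (Quot (fun B B' : {B : _root_.Matrix (Fin (p - 1)) (Fin (p - 1)) ℤ // B ^ p = 1 ∧ B ≠ 1} =>
        ∃ Q : _root_.Matrix (Fin (p - 1)) (Fin (p - 1)) ℤ, IsUnit Q.det ∧ Q * B.1 = B'.1 * Q)) =
      Fintype.card (ClassGroup (𝓞 K)) := by
  haveI : NeZero p := ⟨hp.out.ne_zero⟩
  rw [← natCard_quot_conj_charpoly_cyclotomic K (Nat.totient_prime hp.out)]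
  set rC := (fun B B' : {B : _root_.Matrix (Fin (p - 1)) (Fin (p - 1)) ℤ // B.charpoly = cyclotomic p ℤ} =>
    ∃ Q : _root_.Matrix (Fin (p - 1)) (Fin (p - 1)) ℤ, IsUnit Q.det ∧ Q * B.1 = B'.1 * Q) with hrC
  let e : {B : _root_.Matrix (Fin (p - 1)) (Fin (p - 1)) ℤ // B ^ p = 1 ∧ B ≠ 1} ≃
      {B : _root_.Matrix (Fin (p - 1)) (Fin (p - 1)) ℤ // B.charpoly = cyclotomic p ℤ} :=
    Equiv.subtypeEquivRight fun B => pow_prime_eq_one_and_ne_one_iff_charpoly_eq_cyclotomic B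
  exact Nat.card_congr (Quot.congr (rb := rC) e fun B B' => Iff.rfl)

/-- **The same count inside the group `GL_{p−1}(ℤ) = (M_{p−1}(ℤ))ˣ`: the elements of order `p`, modulo conjugacy
(`IsConj`), form exactly `h(ℚ(ζ_p))` classes** — an integer matrix with `B^p = 1` is unimodular, `orderOf B = p` iff
`B^p = 1 ∧ B ≠ 1` (`p` prime), and `c g c⁻¹ = g′` in `GL_{p−1}(ℤ)` iff `Qg = g′Q` with `det Q = ±1`.
[cite: Brzezinski1990, (0.1) Theorem (with `f = Φ_p`, `n = p − 1`: «the `Λ* = GL_n(ℤ)`-orbits … the action of `Λ*` is defined by conjugation»), p. 21] [cite: Taussky1949, Thms. 1–4] -/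
theorem natCard_quot_isConj_orderOf_eq_prime (K : Type) [Field K] [NumberField K] [IsCyclotomicExtension {p} ℚ K] :
    Nat.card (Quot (fun g g' : {g : (_root_.Matrix (Fin (p - 1)) (Fin (p - 1)) ℤ)ˣ // orderOf g = p} =>
        IsConj g.1 g'.1)) =
      Fintype.card (ClassGroup (𝓞 K)) := by
  rw [← natCard_quot_conj_pow_prime_eq_one (p := p) K]
  set rP := (fun B B' : {B : _root_.Matrix (Fin (p - 1)) (Fin (p - 1)) ℤ // B ^ p = 1 ∧ B ≠ 1} =>
    ∃ Q : _root_.Matrix (Fin (p - 1)) (Fin (p - 1)) ℤ, IsUnit Q.det ∧ Q * B.1 = B'.1 * Q) with hrP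
  -- order `p` in the unit group ⟺ `B^p = 1 ∧ B ≠ 1` for the underlying matrix, which is then a unit
  have hord : ∀ g : (_root_.Matrix (Fin (p - 1)) (Fin (p - 1)) ℤ)ˣ,
      orderOf g = p ↔ (g : _root_.Matrix (Fin (p - 1)) (Fin (p - 1)) ℤ) ^ p = 1 ∧
        (g : _root_.Matrix (Fin (p - 1)) (Fin (p - 1)) ℤ) ≠ 1 := fun g => by
    rw [← orderOf_units, orderOf_eq_prime_iff]
  have hunit : ∀ B : {B : _root_.Matrix (Fin (p - 1)) (Fin (p - 1)) ℤ // B ^ p = 1 ∧ B ≠ 1}, IsUnit B.1 :=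
    fun B => IsUnit.of_pow_eq_one B.2.1 hp.out.ne_zero
  let e : {g : (_root_.Matrix (Fin (p - 1)) (Fin (p - 1)) ℤ)ˣ // orderOf g = p} ≃
      {B : _root_.Matrix (Fin (p - 1)) (Fin (p - 1)) ℤ // B ^ p = 1 ∧ B ≠ 1} :=
    { toFun := fun g => ⟨(g.1 : _root_.Matrix (Fin (p - 1)) (Fin (p - 1)) ℤ), (hord g.1).mp g.2⟩
      invFun := fun B => ⟨(hunit B).unit, (hord _).mpr (by rw [IsUnit.unit_spec]; exact B.2)⟩
      left_inv := fun g => Subtype.ext (Units.ext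
        (hunit ⟨(g.1 : _root_.Matrix (Fin (p - 1)) (Fin (p - 1)) ℤ), (hord g.1).mp g.2⟩).unit_spec)
      right_inv := fun B => Subtype.ext (hunit B).unit_spec }
  refine Nat.card_congr (Quot.congr (rb := rP) e fun g g' => ?_)
  change IsConj g.1 g'.1 ↔ ∃ Q : _root_.Matrix (Fin (p - 1)) (Fin (p - 1)) ℤ, IsUnit Q.det ∧
    Q * (g.1 : _root_.Matrix (Fin (p - 1)) (Fin (p - 1)) ℤ) = (g'.1 : _root_.Matrix (Fin (p - 1)) (Fin (p - 1)) ℤ) * Q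
  rw [isConj_iff]
  constructor
  · rintro ⟨c, hc⟩
    refine ⟨(c : _root_.Matrix (Fin (p - 1)) (Fin (p - 1)) ℤ), (Matrix.isUnit_iff_isUnit_det _).mp c.isUnit, ?_⟩
    rw [mul_inv_eq_iff_eq_mul] at hc
    have := congrArg Units.val hc
    simpa only [Units.val_mul] using this
  · rintro ⟨Q, hQ, hQg⟩
    have hQu : IsUnit Q := (Matrix.isUnit_iff_isUnit_det Q).mpr hQ
    refine ⟨hQu.unit, ?_⟩
    rw [mul_inv_eq_iff_eq_mul]
    apply Units.ext
    simp only [Units.val_mul, IsUnit.unit_spec]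
    exact hQg

end PrimeOrder

end Literature.LinearAlgebra.Matrix.CyclotomicIntegerMatrixClasses
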